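import Summits.QuantumFields.BalabanUV.T4Continuum.Support.NE7SoftOperatorInverses
import Summits.QuantumFields.BalabanUV.T4Continuum.Support.NE7SoftOperatorEnergyForm
import Summits.QuantumFields.BalabanUV.T4Continuum.Support.NE3BlockPoincareTangent

/-!
# NE7ConstrainedPoincareLift — THE LIFT PIECE OF THE CONSTRAINED POINCARÉ INEQUALITY (CP_W) OF F212: every coarse skew torus 1-form `m` has a lift `r` with `Q̄_W r = m` EXACTLY and
# `dirSq(extF r) ≤ n·(liftC∕(1−θ_loc))²·(M^d∕M²)·⟪m, m⟫` (`M = L^{j+1}`; row NE3's right inverse `covLift ∘ solveW` of `QbarRightInverseB8` with its ℓ²-letter (R1)) — i.e. (CP_W) holds on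
# the lifted (averaged) component with `C₁ = 0`, `C₂ = n·(liftC∕(1−θ_loc))²·M^{d−2}` (file 143 of the curved (APE), F214)

Cell `pub-balaban`, rung (B)+1 sub-cell t4, lineage `b2b-balaban-t4-ne7-p1` (CRUX PROVER NE7 #1 = OWNER of row NE7), generation 85; memo
`t4/b2b-balaban-t4-ne7-p1-g85/LAGRANGE-CARRIER.md` §13.
WHY.  F212 reduced (P_a) to (CP_W) «`dirSq(Fb) ≤ C₁·(curlSq_W(Fb)∕n + ‖R D_W† b‖²) + C₂·‖Q̄_W b‖²`», assembled over `b = t + D_Wμ + r` by the triangle inequality (memo §13): F213 is the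
pure-gauge piece; THIS file is the lift piece — the component `r` carrying the average `Q̄_W b` is the covariant lift of the solved datum (F198's surjectivity witness), and row NE3's
letter (R1) `NE3.QbarRightInverseB8.covLift_solveW_R1` bounds its `dirSq` by `dirSq` of the datum, which is at most `n·‖m‖²` (operator vs normalised Hilbert–Schmidt squares,
`NE3BlockPoincareTangent.dirSq_le_card_mul_sum_nhs` + `norm_sq_eq_sum_extF`).  The power `M^{d−2}` is the tree's normalisation of `Q̄` (unweighted sums, memo §9); it multiplies
`‖Q̄ b‖²` only, so in F212's regime it is absorbed by the free mass `a` (`28dη·C₂ < a`).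
WHAT ([folklore]; 0 def, 0 sorry).  `dirSq_extF_le_card_mul_inner` (`dirSq (extF m) (periodBox N) ≤ n·⟪m, m⟫`), **`exists_lift_dirSq_le`** (the title), and its (CP_W)-shaped
corollary **`constrainedPoincare_lift`** (`dirSq(extF r) ≤ C₂·⟪Q̄ r, Q̄ r⟫` for the lift `r` of any datum).
HONEST FRAMING (page 1): (CP_W) on ALL skew forms NOT proved (the slice piece on `T_A` and the decomposition with its curl ∕ gauge-fixing bookkeeping remain); (P_a) NOT proved;
(KL-B) at curved `W` NOT proved; (APE) on curved data NOT proved; NOT ONE-STEP, NOT NE7; spine 0∕9; finite T⁴ rung (B)+1 — NOT infinite volume, NOT mass gap, NOT `BetaPertH`, NOT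
Clay.  Continuum YM on T⁴ ⇐ BetaPertH ∧ nine spine estimates (0/9 proved); BetaPertH ⇐ (D1) ∧ (D4) ∧ CAP+tail; G-an2-4 gates asym, D1 and NE2/3/4.
-/

set_option autoImplicit false

open scoped BigOperators InnerProductSpace Matrix Matrix.Norms.L2Operator
open Finset

namespace Summit.QuantumFields.BalabanUV.T4Continuum.NE7ConstrainedPoincareLift

open Literature.MathematicalPhysics.QuantumFieldTheory.Balaban1983to89
open B7Prop1Explicit B7Prop2Explicit UnitaryModel MatrixNorms
open T4AveragingDeficitWall (IsUnitaryCfg IsSkewDir SmallField dirSq curlSq)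
open T4AveragingDeficitWallBoundary (periodBox IsPeriodicCfg)
open AveragingDeficitPeriodicCounting (IsPeriodicDir)
open AveragingDeficitMultiLevelPrep (LevelSmall tower)
open AveragingDeficitTwoLevelPrep (skewSub)
open AveragingDeficitTorusChart (TDir extDir)
open NE3TangentCovariantTower (QbarIter)
open NE3HilbertSchmidtTorus
open NE3CovariantLift (covLift)
open NE3QbarIterCovLiftPrep (cruxC liftC)
open NE3FramePotBoundW (tower_eq_pow_mul)
open NE3SmoothRightInverseW (solveW resSkew)
open NE3RightInverseSolveLetters (thetaLoc)
open NE3.QbarRightInverseB8 (QbarIter_covLift_solveW covLift_solveW_skew covLift_solveW_periodic covLift_solveW_R1)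
open NE3BlockPoincareTangent (dirSq_le_card_mul_sum_nhs)
open NE7BalabanSoftOperator

noncomputable section

variable {d : ℕ} {n : Type*} [Fintype n] [DecidableEq n]

/-- `dirSq (extF m) (periodBox P) ≤ n·⟪m, m⟫` for a torus 1-form `m` (operator squares against the normalised Hilbert–Schmidt norm of the carrier). [folklore] -/
theorem dirSq_extF_le_card_mul_inner (P : ℕ) [NeZero P] (m : Form d n P) :
    dirSq (extF P m) (periodBox (d := d) P) ≤ Fintype.card n * ⟪m, m⟫_ℝ := by
  rw [real_inner_self_eq_norm_sq, norm_sq_eq_sum_extF]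
  exact dirSq_le_card_mul_sum_nhs _ _

section Carrier

variable [Nonempty n] {L N : ℕ} [NeZero N] (hL : 1 ≤ L) (hL2 : 2 ≤ L) (j : ℕ) [NeZero (N * L ^ (j + 1))]
  {W : Site d → Fin d → (Matrix n n ℂ)ˣ} {x : ℝ} (hWu : IsUnitaryCfg W) (hWP : IsPeriodicCfg W ((N * L ^ (j + 1) : ℕ) : ℤ))
  (hx : 0 ≤ x) (hs : LevelSmall d L j x) (hWx : SmallField W x)
  (hθ : cruxC d L * (((L : ℝ) ^ (j + 1)) ^ 2 * x) < 1) (hθl : thetaLoc d L * (((L : ℝ) ^ (j + 1)) ^ 2 * x) < 1) (hd : 1 ≤ d)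

include hL2 hWP hθ hθl hd in
/-- **THE LIFT WITH ITS ℓ²-LETTER**: every coarse skew torus 1-form `m` is `Q̄_W r` for a fine skew torus 1-form `r` (the covariant lift of the solved datum) with
`dirSq (extF r) (periodBox (N·M)) ≤ n·(liftC∕(1−θ_loc·M²x))²·(M^d∕M²)·⟪m, m⟫`, `M = L^{j+1}`. [folklore] -/
theorem exists_lift_dirSq_le (m : skewForms d n N) :
    ∃ r : skewForms d n (N * L ^ (j + 1)), qbarOpK (N := N) hL j hWu hx hs hWx r = m ∧
      dirSq (extF (N * L ^ (j + 1)) (r : Form d n (N * L ^ (j + 1)))) (periodBox (d := d) (N * L ^ (j + 1)))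
        ≤ Fintype.card n * ((liftC d / (1 - thetaLoc d L * (((L : ℝ) ^ (j + 1)) ^ 2 * x))) ^ 2 * (((L : ℝ) ^ (j + 1)) ^ d / ((L : ℝ) ^ (j + 1)) ^ 2))
          * ⟪m, m⟫_ℝ := by
  have hT : ((tower L N (j + 1) : ℕ) : ℤ) = ((N * L ^ (j + 1) : ℕ) : ℤ) := by rw [tower_eq_pow_mul, Nat.mul_comm]
  have hWP' : IsPeriodicCfg W ((tower L N (j + 1) : ℕ) : ℤ) := by rw [hT]; exact hWP
  have hφ : IsSkewDir (extF N (m : Form d n N)) := m.2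
  have hφP : IsPeriodicDir (extF N (m : Form d n N)) (N : ℤ) := isPeriodicDir_extF _ _
  set Y := covLift (L ^ (j + 1)) W (extDir N ((solveW hL2 j hWu hx hs hWx N hθ (resSkew N hφ) : ↥(skewSub d n N)) : TDir d n N)) with hY
  have hYQ : QbarIter L (j + 1) W Y = extF N (m : Form d n N) := QbarIter_covLift_solveW hL2 j hWu hWP' hx hs hWx hθ hφ hφP
  have hYs : IsSkewDir Y := covLift_solveW_skew hL2 j hWu hx hs hWx hθ hφ
  have hYP : IsPeriodicDir Y ((N * L ^ (j + 1) : ℕ) : ℤ) := covLift_solveW_periodic hL2 j hWu hWP' hx hs hWx hθ hφ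
  refine ⟨⟨resF (N * L ^ (j + 1)) Y, resF_mem_skewForms hYs⟩, Subtype.ext ?_, ?_⟩
  · rw [coe_qbarOpK, Submodule.coe_mk, extF_resF _ hYP, hYQ, resF_extF]
  · rw [Submodule.coe_mk, extF_resF _ hYP, hY]
    have h1 := covLift_solveW_R1 (N := N) hL2 j hWu hx hs hWx hθ hθl hφ hd
    have h2 := dirSq_extF_le_card_mul_inner N (m : Form d n N)
    have hc : 0 ≤ (liftC d / (1 - thetaLoc d L * (((L : ℝ) ^ (j + 1)) ^ 2 * x))) ^ 2 * (((L : ℝ) ^ (j + 1)) ^ d / ((L : ℝ) ^ (j + 1)) ^ 2) := by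
      positivity
    calc dirSq (covLift (L ^ (j + 1)) W (extDir N ((solveW hL2 j hWu hx hs hWx N hθ (resSkew N hφ) : ↥(skewSub d n N)) : TDir d n N)))
          (periodBox (d := d) (N * L ^ (j + 1)))
        ≤ (liftC d / (1 - thetaLoc d L * (((L : ℝ) ^ (j + 1)) ^ 2 * x))) ^ 2 * (((L : ℝ) ^ (j + 1)) ^ d / ((L : ℝ) ^ (j + 1)) ^ 2)
            * dirSq (extF N (m : Form d n N)) (periodBox (d := d) N) := h1
      _ ≤ (liftC d / (1 - thetaLoc d L * (((L : ℝ) ^ (j + 1)) ^ 2 * x))) ^ 2 * (((L : ℝ) ^ (j + 1)) ^ d / ((L : ℝ) ^ (j + 1)) ^ 2)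
            * (Fintype.card n * ⟪(m : Form d n N), (m : Form d n N)⟫_ℝ) := mul_le_mul_of_nonneg_left h2 hc
      _ = _ := by rw [Submodule.coe_inner]; ring

include hL2 hWP hθ hθl hd in
/-- **(CP_W) ON LIFTS, IN F212's SHAPE**: the lift `r` of `m` satisfies `dirSq (extF r) ≤ C₂·⟪Q̄ r, Q̄ r⟫` with `C₂ = n·(liftC∕(1−θ_loc·M²x))²·M^{d−2}` (so `C₁ = 0`). [folklore] -/
theorem constrainedPoincare_lift (m : skewForms d n N) :
    ∃ r : skewForms d n (N * L ^ (j + 1)), qbarOpK (N := N) hL j hWu hx hs hWx r = m ∧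
      dirSq (extF (N * L ^ (j + 1)) (r : Form d n (N * L ^ (j + 1)))) (periodBox (d := d) (N * L ^ (j + 1)))
        ≤ Fintype.card n * ((liftC d / (1 - thetaLoc d L * (((L : ℝ) ^ (j + 1)) ^ 2 * x))) ^ 2 * (((L : ℝ) ^ (j + 1)) ^ d / ((L : ℝ) ^ (j + 1)) ^ 2))
          * ⟪qbarOpK (N := N) hL j hWu hx hs hWx r, qbarOpK (N := N) hL j hWu hx hs hWx r⟫_ℝ := by
  obtain ⟨r, hr, hle⟩ := exists_lift_dirSq_le (N := N) hL hL2 j hWu hWP hx hs hWx hθ hθl hd m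
  exact ⟨r, hr, by rwa [hr]⟩

end Carrier

end

end Summit.QuantumFields.BalabanUV.T4Continuum.NE7ConstrainedPoincareLift
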